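import Summits.ResolutionOfSingularities.ResolutionOfSingularities.Theses.JacobianBudget
import Summits.ResolutionOfSingularities.ResolutionOfSingularities.Theorems.NoPeriodicIsolatedAtom.Negative.FalseWithoutMultP
import Summits.ResolutionOfSingularities.ResolutionOfSingularities.Theorems.NoPeriodicIsolatedAtom.Negative.FalseWithoutRpos

/-!
# `IsolatedJacobianDrop` (crux stmt-ResolutionOfSingularities-18946, route `JacobianBudget`):
# the decrement `Δ₁(p) = p` is ATTAINED — the budget constant cannot be improved
# (tightness lemma from the crux-disprover seat; this file does NOT refute the crux)

The crux (its `let`-block is, definitionally, the landed mirror calculus `clean bl ord dv tr step run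
ser pd jac` of `Theorems/NoPeriodicIsolatedAtom/Negative/FalseWithoutIsol.lean` — see `crux_iff` in
`IsolatedJacobianDrop/Negative/FalseWithoutMultP.lean`) asserts `μ(stage m+1) + Δ_n(p) ≤ μ(stage m)`
along isolated multiplicity-`p` transitions, `Δ_n(p) = ((p-1)^n(p+1) + 1 - 2((n+1) % 2))/p`.

Here, sorry-free: at `(p, n, κ) = (2, 1, 𝔽₂)` the transition `u⁵ ↦ u³` (the atoms `z² = u⁵ ↦ z² = u³`;
chart and translation are forced in one variable) satisfies ALL FOUR hypotheses of the crux and its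
conclusion WITH EQUALITY — `μ(u⁵) = dim κ[[u]] ⧸ (u⁴) = 4`, `μ(u³) = dim κ[[u]] ⧸ (u²) = 2`,
`Δ₁(2) = ((2-1)^1·3 + 1 - 0)/2 = 2` — so the same statement with `Δ + 1` in place of `Δ` is FALSE
(`isolatedJacobianDrop_tight_n1`).  In one variable this is the general picture: `u^d ↦ u^{d-p}`,
`μ: d - 1 ↦ d - p - 1`, slack `0` at EVERY transition (the item's censuses record slack `0` in every
`(p, n)` tested; `n = 1` is where it is forced).

On the way, two reusable facts about `κ[[u]] ⧸ (u^k)` for `MvPowerSeries (Fin 1)` (not in Mathlib in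
this form): it is spanned by `1, u, …, u^{k-1}` (`MvPowerSeries.X_pow_dvd_iff`) and these are
independent, hence `finrank = k` (`finrank_quot_X_pow`).  No definition, no notation; kernel-only.
-/

noncomputable section

-- single-problem summit: the doubled namespace component `ResolutionOfSingularities` is forced by the tree layout
set_option linter.dupNamespace false

namespace Summit.ResolutionOfSingularities.ResolutionOfSingularities.Theorems.IsolatedJacobianDrop.Negative

open Summit.ResolutionOfSingularities.ResolutionOfSingularities.Theorems.NoPeriodicIsolatedAtom.Negative
  (clean bl ord dv tr step run ser pd jac bl_one dv_zero_shift tr_one clean_ucube multP_ucube jac_ucube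
    ucube_ne_zero_iff)
open scoped BigOperators Classical

/-! ## `κ[[u]] ⧸ (u^k)` has dimension `k` -/

/-- Modulo `u^k`, every power series in one variable is its Taylor polynomial of degree `< k`. [folklore] -/
lemma X_pow_dvd_sub_taylor {κ : Type} [Field κ] (k : ℕ) (f : MvPowerSeries (Fin 1) κ) :
    (MvPowerSeries.X 0 : MvPowerSeries (Fin 1) κ) ^ k ∣
      f - ∑ j ∈ Finset.range k, MvPowerSeries.C (MvPowerSeries.coeff (Finsupp.single 0 j) f) * MvPowerSeries.X 0 ^ j := by
  rw [MvPowerSeries.X_pow_dvd_iff]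
  intro m hm
  -- in one variable every exponent vector is `single 0 (m 0)`
  -- (`Literature.NumberTheory.DiophantineGeometry.Roth.finsupp_fin_one_eq`, inlined to keep imports light)
  have hm1 : m = Finsupp.single 0 (m 0) :=
    Finsupp.ext fun j => by rw [Fin.fin_one_eq_zero j, Finsupp.single_eq_same]
  rw [map_sub, map_sum, sub_eq_zero]
  simp only [MvPowerSeries.coeff_C_mul, MvPowerSeries.coeff_X_pow]
  rw [Finset.sum_eq_single (m 0)]
  · rw [if_pos hm1, mul_one, ← hm1]
  · intro j _ hj
    rw [if_neg, mul_zero]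
    intro h
    apply hj
    rw [h, Finsupp.single_eq_same]
  · intro h
    exact absurd (Finset.mem_range.mpr hm) h

/-- `κ[[u]] ⧸ (u^k)` is spanned over `κ` by the classes of `1, u, …, u^{k-1}`. [folklore] -/
lemma span_quot_X_pow {κ : Type} [Field κ] (k : ℕ) :
    Submodule.span κ (Set.range fun j : Fin k =>
      Ideal.Quotient.mk (Ideal.span {(MvPowerSeries.X 0 : MvPowerSeries (Fin 1) κ) ^ k}) (MvPowerSeries.X 0 ^ (j : ℕ))) = ⊤ := by
  set R := MvPowerSeries (Fin 1) κ with hR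
  set I : Ideal R := Ideal.span {(MvPowerSeries.X 0 : R) ^ k} with hI
  rw [eq_top_iff]
  rintro q -
  obtain ⟨f, rfl⟩ := Ideal.Quotient.mk_surjective q
  obtain ⟨g, hg⟩ := X_pow_dvd_sub_taylor k f
  have hf : f = (∑ j ∈ Finset.range k, MvPowerSeries.C (MvPowerSeries.coeff (Finsupp.single 0 j) f) * MvPowerSeries.X 0 ^ j)
      + (MvPowerSeries.X 0) ^ k * g := by
    rw [← hg]; ring
  have hmem : (MvPowerSeries.X 0 : R) ^ k * g ∈ I := Ideal.mul_mem_right _ _ (Ideal.subset_span rfl)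
  rw [hf, map_add, Ideal.Quotient.eq_zero_iff_mem.mpr hmem, add_zero, map_sum]
  refine Submodule.sum_mem _ fun j hj => ?_
  rw [map_mul, MvPowerSeries.c_eq_algebraMap, Ideal.Quotient.mk_algebraMap, ← Algebra.smul_def]
  refine Submodule.smul_mem _ _ (Submodule.subset_span ⟨⟨j, Finset.mem_range.mp hj⟩, rfl⟩)

/-- The classes of `1, u, …, u^{k-1}` are `κ`-linearly independent in `κ[[u]] ⧸ (u^k)` (a relation
would be a series of degree `< k` divisible by `u^k`). [folklore] -/
lemma linearIndependent_quot_X_pow {κ : Type} [Field κ] (k : ℕ) :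
    LinearIndependent κ (fun j : Fin k =>
      Ideal.Quotient.mk (Ideal.span {(MvPowerSeries.X 0 : MvPowerSeries (Fin 1) κ) ^ k}) (MvPowerSeries.X 0 ^ (j : ℕ))) := by
  set R := MvPowerSeries (Fin 1) κ with hR
  set I : Ideal R := Ideal.span {(MvPowerSeries.X 0 : R) ^ k} with hI
  rw [Fintype.linearIndependent_iff]
  intro g hg j
  have hsum : Ideal.Quotient.mk I (∑ i : Fin k, MvPowerSeries.C (g i) * MvPowerSeries.X 0 ^ (i : ℕ)) =
      ∑ i : Fin k, g i • Ideal.Quotient.mk I (MvPowerSeries.X 0 ^ (i : ℕ)) := by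
    rw [map_sum]
    refine Finset.sum_congr rfl fun i _ => ?_
    rw [map_mul, MvPowerSeries.c_eq_algebraMap, Ideal.Quotient.mk_algebraMap, ← Algebra.smul_def]
  have hmem : (∑ i : Fin k, MvPowerSeries.C (g i) * MvPowerSeries.X 0 ^ (i : ℕ)) ∈ I := by
    rw [← Ideal.Quotient.eq_zero_iff_mem, hsum, hg]
  have hdvd : (MvPowerSeries.X 0 : R) ^ k ∣ ∑ i : Fin k, MvPowerSeries.C (g i) * MvPowerSeries.X 0 ^ (i : ℕ) := by
    rwa [hI, Ideal.mem_span_singleton] at hmem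
  have hcoeff := (MvPowerSeries.X_pow_dvd_iff.mp hdvd) (Finsupp.single 0 (j : ℕ)) (by simp)
  rw [map_sum] at hcoeff
  simp only [MvPowerSeries.coeff_C_mul, MvPowerSeries.coeff_X_pow] at hcoeff
  rw [Finset.sum_eq_single j] at hcoeff
  · simpa using hcoeff
  · intro i _ hij
    rw [if_neg, mul_zero]
    intro h
    apply hij
    exact Fin.ext ((Finsupp.single_injective (0 : Fin 1)) h).symm
  · intro h
    exact absurd (Finset.mem_univ j) h

/-- `κ[[u]] ⧸ (u^k)` is finite over `κ`. [folklore] -/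
lemma finite_quot_X_pow {κ : Type} [Field κ] (k : ℕ) :
    Module.Finite κ (MvPowerSeries (Fin 1) κ ⧸ Ideal.span {(MvPowerSeries.X 0 : MvPowerSeries (Fin 1) κ) ^ k}) :=
  ⟨⟨Finset.image (fun j : Fin k => Ideal.Quotient.mk (Ideal.span {(MvPowerSeries.X 0 : MvPowerSeries (Fin 1) κ) ^ k})
      (MvPowerSeries.X 0 ^ (j : ℕ))) Finset.univ, by
    rw [Finset.coe_image, Finset.coe_univ, Set.image_univ]; exact span_quot_X_pow k⟩⟩

/-- **`dim_κ κ[[u]] ⧸ (u^k) = k`.** [folklore] -/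
lemma finrank_quot_X_pow {κ : Type} [Field κ] (k : ℕ) :
    Module.finrank κ (MvPowerSeries (Fin 1) κ ⧸ Ideal.span {(MvPowerSeries.X 0 : MvPowerSeries (Fin 1) κ) ^ k}) = k := by
  haveI := finite_quot_X_pow (κ := κ) k
  apply le_antisymm
  · have h := finrank_range_le_card (R := κ) (fun j : Fin k =>
      Ideal.Quotient.mk (Ideal.span {(MvPowerSeries.X 0 : MvPowerSeries (Fin 1) κ) ^ k}) (MvPowerSeries.X 0 ^ (j : ℕ)))
    rw [Set.finrank, span_quot_X_pow k, finrank_top, Fintype.card_fin] at h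
    exact h
  · simpa using (linearIndependent_quot_X_pow (κ := κ) k).fintype_card_le_finrank

/-! ## The transition `u⁵ ↦ u³` at `p = 2` -/

-- the start `u⁵` over `𝔽₂`, written out as the lambda `fun A => if A = ![5] then 1 else 0` (no definition)

/-- `u⁵` is supported exactly on the exponent `5`. [folklore] -/
lemma ufive_ne_zero_iff (A : Fin 1 → ℕ) :
    (fun A : Fin 1 → ℕ => if A = ![5] then (1 : ZMod 2) else 0) A ≠ 0 ↔ A = ![5] := by
  by_cases h : A = ![5] <;> simp [h]

/-- `u⁵` is `2`-clean. [folklore] -/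
lemma clean_ufive :
    clean 2 (fun A : Fin 1 → ℕ => if A = ![5] then (1 : ZMod 2) else 0) =
      (fun A : Fin 1 → ℕ => if A = ![5] then (1 : ZMod 2) else 0) := by
  funext A
  unfold clean
  by_cases h : ∀ j, 2 ∣ A j
  · rw [if_pos h]
    by_cases hA : A = ![5]
    · exact absurd (h 0) (by simp [hA])
    · simp [hA]
  · rw [if_neg h]

/-- The order of `u⁵` is `5`. [folklore] -/
lemma ord_ufive : ord (fun A : Fin 1 → ℕ => if A = ![5] then (1 : ZMod 2) else 0) = 5 := by
  unfold ord
  have hset : {m : ℕ | ∃ A, (fun A : Fin 1 → ℕ => if A = ![5] then (1 : ZMod 2) else 0) A ≠ 0 ∧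
      m = Finset.sum Finset.univ (fun j => A j)} = {5} := by
    ext m
    simp only [Set.mem_setOf_eq, Set.mem_singleton_iff, ufive_ne_zero_iff]
    constructor
    · rintro ⟨A, rfl, rfl⟩
      simp
    · rintro rfl
      exact ⟨![5], rfl, by simp⟩
  rw [hset, csInf_singleton]

/-- `u⁵` has multiplicity `2`. [folklore] -/
lemma multP_ufive :
    (∃ A, clean 2 (fun A : Fin 1 → ℕ => if A = ![5] then (1 : ZMod 2) else 0) A ≠ 0) ∧
      ∀ A, clean 2 (fun A : Fin 1 → ℕ => if A = ![5] then (1 : ZMod 2) else 0) A ≠ 0 →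
        2 ≤ Finset.sum Finset.univ (fun j => A j) := by
  rw [clean_ufive]
  refine ⟨⟨![5], by simp⟩, ?_⟩
  intro A hA
  rw [ufive_ne_zero_iff] at hA
  subst hA
  simp

/-- Dividing `u⁵` by `u²` gives `u³`. [folklore] -/
lemma dv_two_ufive :
    dv 0 2 (fun A : Fin 1 → ℕ => if A = ![5] then (1 : ZMod 2) else 0) =
      (fun A : Fin 1 → ℕ => if A = ![3] then (1 : ZMod 2) else 0) := by
  funext B
  unfold dv
  beta_reduce
  have key : (Function.update B 0 (B 0 + 2) = ![5]) ↔ B = ![3] := by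
    constructor
    · intro h
      have h0 := congrFun h 0
      simp [Function.update] at h0
      funext j
      rw [Fin.fin_one_eq_zero j]
      simp
      omega
    · intro h
      subst h
      funext j
      rw [Fin.fin_one_eq_zero j]
      simp [Function.update]
  by_cases hB : B = ![3]
  · rw [if_pos (key.mpr hB), if_pos hB]
  · rw [if_neg (fun h => hB (key.mp h)), if_neg hB]

/-- **The step** `u⁵ ↦ u³` (cleaned order `5 ≥ 2`: divide by `u²`). [folklore] -/
lemma step_ufive (i : Fin 1) (τ : Fin 1 → ZMod 2) :
    step 2 i τ (fun A : Fin 1 → ℕ => if A = ![5] then (1 : ZMod 2) else 0) =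
      (fun A : Fin 1 → ℕ => if A = ![3] then (1 : ZMod 2) else 0) := by
  rw [Fin.fin_one_eq_zero i]
  unfold step
  rw [clean_ufive, ord_ufive, if_pos (by norm_num : 2 ≤ 5), bl_one, dv_two_ufive, tr_one, clean_ucube]

/-- `∂(u⁵)/∂u = 5u⁴ = u⁴` over `𝔽₂`. [folklore] -/
lemma pd_ufive :
    pd 0 (ser 2 (fun A : Fin 1 → ℕ => if A = ![5] then (1 : ZMod 2) else 0)) = MvPowerSeries.X 0 ^ 4 := by
  refine MvPowerSeries.ext fun A => ?_
  rw [MvPowerSeries.coeff_X_pow]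
  change ((A 0 + 1 : ℕ) : ZMod 2) * clean 2 (fun A : Fin 1 → ℕ => if A = ![5] then (1 : ZMod 2) else 0)
    ((A + Finsupp.single (0 : Fin 1) 1 : Fin 1 →₀ ℕ) : Fin 1 → ℕ) = _
  rw [clean_ufive]
  beta_reduce
  have key : (((A + Finsupp.single (0 : Fin 1) 1 : Fin 1 →₀ ℕ) : Fin 1 → ℕ) = ![5]) ↔
      A = Finsupp.single 0 4 := by
    constructor
    · intro h
      have h0 := congrFun h 0
      simp at h0
      refine Finsupp.ext fun j => ?_
      rw [Fin.fin_one_eq_zero j]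
      simp
      omega
    · rintro rfl
      funext j
      rw [Fin.fin_one_eq_zero j]
      simp
  by_cases hA : A = Finsupp.single 0 4
  · rw [if_pos (key.mpr hA), if_pos hA, hA]
    simp
    decide
  · rw [if_neg (fun h => hA (key.mp h)), if_neg hA, mul_zero]

/-- The Jacobian ideal of `u⁵` over `𝔽₂` is `(u⁴)`. [folklore] -/
lemma jac_ufive :
    jac 2 (fun A : Fin 1 → ℕ => if A = ![5] then (1 : ZMod 2) else 0) =
      Ideal.span {(MvPowerSeries.X 0 : MvPowerSeries (Fin 1) (ZMod 2)) ^ 4} := by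
  unfold jac
  rw [Set.range_unique]
  show Ideal.span {pd (default : Fin 1) (ser 2 (fun A : Fin 1 → ℕ => if A = ![5] then (1 : ZMod 2) else 0))} = _
  rw [Fin.default_eq_zero, pd_ufive]

/-! ## Tightness -/

/-- **`Δ₁(p)` is attained: the budget constant of `IsolatedJacobianDrop` cannot be improved.**
At `(p, n, κ) = (2, 1, 𝔽₂)`, start `u⁵`, the (forced) chart `0`, translation `0`, `m = 0`: the four
hypotheses of the crux hold at stages `0` and `1` (`u⁵`, `u³`: clean, multiplicity `2`, Jacobian
algebras `κ[[u]] ⧸ (u⁴)` and `κ[[u]] ⧸ (u²)`, finite), the conclusion holds with EQUALITY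
(`μ: 4 ↦ 2`, `Δ₁(2) = ((2-1)^1(2+1) + 1 - 2((1+1) % 2))/2 = 2`, displayed in the crux's own
arithmetic), and the conclusion with `Δ + 1` FAILS.  (General `n = 1` picture: `u^d ↦ u^{d-p}`,
`μ: d-1 ↦ d-p-1`, slack `0` always.) [folklore] -/
theorem isolatedJacobianDrop_tight_n1 :
    let c₀ : (Fin 1 → ℕ) → ZMod 2 := fun A => if A = ![5] then 1 else 0
    Module.Finite (ZMod 2) (MvPowerSeries (Fin 1) (ZMod 2) ⧸ jac 2 (run 2 c₀ (fun _ => 0) (fun _ _ => 0) 0)) ∧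
    ((∃ A, clean 2 (run 2 c₀ (fun _ => 0) (fun _ _ => 0) 0) A ≠ 0) ∧
      ∀ A, clean 2 (run 2 c₀ (fun _ => 0) (fun _ _ => 0) 0) A ≠ 0 → 2 ≤ Finset.sum Finset.univ (fun j => A j)) ∧
    Module.Finite (ZMod 2) (MvPowerSeries (Fin 1) (ZMod 2) ⧸ jac 2 (run 2 c₀ (fun _ => 0) (fun _ _ => 0) 1)) ∧
    ((∃ A, clean 2 (run 2 c₀ (fun _ => 0) (fun _ _ => 0) 1) A ≠ 0) ∧
      ∀ A, clean 2 (run 2 c₀ (fun _ => 0) (fun _ _ => 0) 1) A ≠ 0 → 2 ≤ Finset.sum Finset.univ (fun j => A j)) ∧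
    Module.finrank (ZMod 2) (MvPowerSeries (Fin 1) (ZMod 2) ⧸ jac 2 (run 2 c₀ (fun _ => 0) (fun _ _ => 0) 1)) +
        ((2 - 1) ^ 1 * (2 + 1) + 1 - 2 * ((1 + 1) % 2)) / 2 =
      Module.finrank (ZMod 2) (MvPowerSeries (Fin 1) (ZMod 2) ⧸ jac 2 (run 2 c₀ (fun _ => 0) (fun _ _ => 0) 0)) ∧
    ¬ (Module.finrank (ZMod 2) (MvPowerSeries (Fin 1) (ZMod 2) ⧸ jac 2 (run 2 c₀ (fun _ => 0) (fun _ _ => 0) 1)) +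
        (((2 - 1) ^ 1 * (2 + 1) + 1 - 2 * ((1 + 1) % 2)) / 2 + 1) ≤
      Module.finrank (ZMod 2) (MvPowerSeries (Fin 1) (ZMod 2) ⧸ jac 2 (run 2 c₀ (fun _ => 0) (fun _ _ => 0) 0))) := by
  intro c₀
  have hrun0 : run 2 c₀ (fun _ => 0) (fun _ _ => 0) 0 = c₀ := rfl
  have hrun1 : run 2 c₀ (fun _ => 0) (fun _ _ => 0) 1 = (fun A : Fin 1 → ℕ => if A = ![3] then (1 : ZMod 2) else 0) :=
    step_ufive 0 _
  have hmu0 : Module.finrank (ZMod 2) (MvPowerSeries (Fin 1) (ZMod 2) ⧸ jac 2 (run 2 c₀ (fun _ => 0) (fun _ _ => 0) 0)) = 4 := by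
    rw [hrun0, jac_ufive, finrank_quot_X_pow]
  have hmu1 : Module.finrank (ZMod 2) (MvPowerSeries (Fin 1) (ZMod 2) ⧸ jac 2 (run 2 c₀ (fun _ => 0) (fun _ _ => 0) 1)) = 2 := by
    rw [hrun1, jac_ucube, finrank_quot_X_pow]
  refine ⟨?_, ?_, ?_, ?_, ?_, ?_⟩
  · rw [hrun0, jac_ufive]; exact finite_quot_X_pow 4
  · rw [hrun0]; exact multP_ufive
  · rw [hrun1, jac_ucube]; exact finite_quot_X_pow 2
  · rw [hrun1]; exact multP_ucube
  · rw [hmu0, hmu1]; norm_num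
  · rw [hmu0, hmu1]; norm_num

end Summit.ResolutionOfSingularities.ResolutionOfSingularities.Theorems.IsolatedJacobianDrop.Negative

end
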